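import Literature.MathematicalPhysics.QuantumFieldTheory.BalabanImbrieJaffe1984to88.BIJ88Expansion5143
import Literature.MathematicalPhysics.QuantumFieldTheory.BalabanImbrieJaffe1984to88.BIJ88ConnectedGraphResummation
import Literature.MathematicalPhysics.QuantumFieldTheory.BalabanImbrieJaffe1984to88.BIJ88VirtualSupports310

/-!
# `BalabanImbrieJaffe1984to88.BIJ88Expansion5143Ordered` — T. Bałaban, J. Imbrie, A. Jaffe, *Effective action and cluster properties of the
abelian Higgs model*, Commun. Math. Phys. **114** (1988) 257–315 [BalabanImbrieJaffe1988], §5.14 pp. 309–310 [PDF 53–54]: **the prime-dropped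
expansion (5.14.3) IS the input `N(K)` of the connected-graph resummation** — the last display of p. 309, *"Σ_{{H_γ}∈𝒫(H)} Σ_{{X_γ},{Y_δ}
nonoverlapping} Π_γ g₃(H_γ,X_γ) Π_δ g₃(∅,Y_δ)"*, which this seat's gen-6 file `BIJ88ConnectedGraphResummation` DEFINED (its READING (b)) as the
ordered, `1/m!`-weighted sum `Nsum Q loc w K` and from which it derived the three displays of p. 310, is here IDENTIFIED with the unordered
covering expansion of `BIJ88Expansion5143` (display (5.14.3) with the prime dropped): READING (a) of gen 6 (*"an unordered nonoverlapping family
of m clusters is counted m! times"*) becomes the theorem `Nraw_fin_eq`, and the whole chain expectation → (5.14.3) → prime dropped → `N(K)` is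
`Nsum_eq_expansion` / `Nsum_vsupp_eq_corner`.

statement-level skeleton of published theorems with citation tags; proofs where landed; nothing here is a claim about the Yang–Mills mass gap

PDF held: `paper:balaban1988-cmp114-bij-abelian-higgs-effective-action` (journal page = PDF page + 256); p. 309 = PDF 53 read as an image
(`lit-balaban-ref-1/renders/cmp114/original-p053-x2.png`), p. 310 = PDF 54 (text `p0054.txt`).

**The print (verbatim, p. 309 [PDF 53]).** *"If |X_β| = 1, H_β = ∅, we write g₃(∅,X_β) = 1 + g₃′(∅,X_β) and the above expansion holds again,
but without the condition that {X_β} fill Λ^{(k)}_{12}. The {X_β} must cover all cubes connected with the (d/dt)_{γ_j}, j ∈ H. Let us drop the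
prime … Returning to our expansion, let us sum first over {H_γ}, the partition of H determined by the {X_β}. Denote the X_β's with H_β ≠ ∅ by
X_γ; the X_β with H_β = ∅ by Y_δ. The expansion (5.14.2) becomes Σ_{{H_γ}∈𝒫(H)} Σ_{{X_γ},{Y_δ} nonoverlapping} Π_γ g₃(H_γ,X_γ) Π_δ g₃(∅,Y_δ).
Each X_γ must cover and connect all the t-derivatives specified by H_γ."*

WHAT IS REPRODUCED (unit `lit-balaban-p25`, generation 10 of the Phase-2 proof seat p25; SKELETON rows `C2.Eq5.14.3-5.14.4` (display (5.14.3))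
and `C2.Claim@310` (first clause, whose derivation in gen 6 took `N(K)` as its starting point) of `HOME/lit-balaban-r16/ROWS-C2-part2.md`; HOME
`run/shared/lean/pub/lit-balaban/`). Objects of gen 6 (`BIJ88ConnectedGraphResummation`): cubes `V`, slots `S`, polymer family `Q`, `loc : S → V`,
activity `w : Finset S → Finset V → ℝ`, ordered labelled families `(H_i, Z_i)_{i∈ι}` constrained by `OWP K` (the `H_i` an ordered weak partition of
`K`), `InQ Q`, `Cov loc` and the overlap hard core `hardCore Z` (`BIJ88RootedUrsell310`); `Nraw`, `Nord m K = Nraw (Fin m) K / m!`, `Nsum K = Σ_m Nord`.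
* §1 COUNTING: `card_filter_injective_piFinset` (the injective `m`-tuples with values in an `m`-set number `m!`, via `Fin m ↪ F` and
  `Fintype.card_embedding_eq`) and `sum_injective_piFinset_eq_smul` (a sum over injective tuples of a function of the image is `m! •` the sum over
  the `m`-subsets) — READING (a) of gen 6.
* §2 THE LABELS ARE FORCED: `owp_cov_iff` — for pairwise disjoint clusters `Z_i`, the labelled families `(H_i)` over `Z` are exactly ONE,
  `H_i = slotsIn loc K Z_i` (*"the partition of H determined by the {X_β}"*), and it exists iff the `Z_i` cover the slots; hence `Nraw_eq_sum_tuples`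
  (gen 6's raw sum as a sum over cluster tuples alone) and **`Nraw_fin_eq`**: `Nraw Q loc w (Fin m) K = m! · Σ_{F ⊆ Q, |F| = m, nonoverlapping, covering}
  Π_{X∈F} w(H(X), X)`; `Nord_eq`, **`Nsum_eq_sum_families`**: `Nsum Q loc w K = Σ_{F ⊆ Q nonoverlapping, covering} Π_{X∈F} w(H(X), X)` (a finite sum:
  at most `|Q|` clusters, `∅ ∉ Q`).
* §3 THE LINK, overlap hard core: with `Q = ` the nonempty sets of cubes of `W`, **`Nsum_eq_sum_setPartitions`**: `Nsum Q loc (prime g) K =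
  Σ_{P filling W} Π_{X∈P} g(H(X), X)` for every activity `g` (by `BIJ88Expansion5143.dropPrime_all`) — gen 6's `N(K)` with the prime-dropped activity
  IS the all-fillings expansion.
* §4 THE LINK, cluster configurations (the fillings of (5.13.4)/(5.14.3) proper, `IsAdmissible`: no two polymers of ≥ 2 cubes abut): by this seat's
  gen-9 VIRTUAL SUPPORTS (`BIJ88VirtualSupports310.vsupp`) the admissibility-cum-disjointness constraint is the overlap hard core of the virtual
  supports (`cinc`, `pairwise_not_cinc_iff`), so gen 6's scheme applies verbatim with `V := ι ⊕ (Finset ι × Finset ι)`; `cubesOf`, `wv`, `locv`,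
  `cubesOf_vsupp`, `slotsIn_vsupp`, `covers_image_vsupp_iff`, **`Nsum_vsupp_eq_expansion`** (`N(K)` over the virtual supports with the pulled-back
  prime-dropped activity = `Σ_{P admissible filling} Π g(H(X),X)`) and **`Nsum_vsupp_eq_corner`**: for slot-local cluster-factorizing corner
  expectations `z` (`BIJ88Expansion5143.expansion5143`), `N(K) = z K W W` — the un-normalized expectation `⟨Π_{j∈K}(d/dt)_{γ_j} Π_{i∈W} f(□_i)⟩_1`,
  as gen 6's READING (b) asserted.

**Honest scope.** Finite identities; `t`, `γ`, the fields are parameters of the activities; no bound ((5.14.4) is the typed leaf `Ineq5144`);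
gen 6's displays 1–3 of p. 310 (`Nsum_eq_mul_Dsum`, `Dsum_eq_sum_setPartitions`, `display3`) are untouched and now start from a DERIVED `N(K)`.
0 `sorry`, 0 new `Prop` facts; imports `BIJ88Expansion5143`, `BIJ88ConnectedGraphResummation`, `BIJ88VirtualSupports310`; modifies nothing. NOT summit
progress; NOT continuum; NOT Clay. Cell `lit-balaban` Phase 2, seat p25 gen 10; rows C2.Eq5.14.3-5.14.4 / C2.Claim@310 (owner r16, referee ref-5).
-/

open Finset
open Literature.Probability.LatticeModels (IsSetPartition setPartitions mem_setPartitions)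
open Literature.MathematicalPhysics.QuantumFieldTheory.BalabanImbrieJaffe1984to88.BIJ88Clusters5134 (IsClusterFactorizing)
open Literature.MathematicalPhysics.QuantumFieldTheory.BalabanImbrieJaffe1984to88.BIJ88PolymerRep5134 (IsAdmissible)
open Literature.MathematicalPhysics.QuantumFieldTheory.BalabanImbrieJaffe1984to88.BIJ88RootedUrsell310 (hardCore)
open Literature.MathematicalPhysics.QuantumFieldTheory.BalabanImbrieJaffe1984to88.BIJ88ConnectedGraphResummation
  (OWP InQ Cov wprod Nraw Nord Nsum Nord_empty_eq_zero)
open Literature.MathematicalPhysics.QuantumFieldTheory.BalabanImbrieJaffe1984to88.BIJ88VirtualSupports310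
  (vsupp inl_mem_vsupp_iff vsupp_injective not_disjoint_vsupp_iff)
open Literature.MathematicalPhysics.QuantumFieldTheory.BalabanImbrieJaffe1984to88.BIJ88Expansion5143

noncomputable section

namespace Literature.MathematicalPhysics.QuantumFieldTheory.BalabanImbrieJaffe1984to88.BIJ88Expansion5143Ordered

/-! ## §1 Counting: an unordered family of `m` clusters is counted `m!` times among the ordered `m`-tuples -/

section Counting

variable {α : Type*} [DecidableEq α]

/-- **the injective `m`-tuples with values in an `m`-element set number `m!`** (they are the enumerations `Fin m ↪ F`).
[cite: BalabanImbrieJaffe1988, p.310 (Sect. 5.14)] -/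
theorem card_filter_injective_piFinset {m : ℕ} {F : Finset α} (hF : F.card = m) :
    ((Fintype.piFinset fun _ : Fin m => F).filter fun Z => Function.Injective Z).card = m.factorial := by
  let T := {Z : Fin m → α // Z ∈ (Fintype.piFinset fun _ : Fin m => F).filter fun Z => Function.Injective Z}
  have e : T ≃ (Fin m ↪ F) :=
    { toFun := fun Z => ⟨fun i => ⟨Z.1 i, Fintype.mem_piFinset.1 (mem_filter.1 Z.2).1 i⟩,
        fun i j h => (mem_filter.1 Z.2).2 (congrArg Subtype.val h)⟩
      invFun := fun e => ⟨fun i => (e i).1, mem_filter.2 ⟨Fintype.mem_piFinset.2 fun i => (e i).2,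
        fun i j h => e.injective (Subtype.ext h)⟩⟩
      left_inv := fun Z => rfl
      right_inv := fun e => rfl }
  rw [← Fintype.card_coe, Fintype.card_congr e, Fintype.card_embedding_eq, Fintype.card_coe, hF, Fintype.card_fin,
    Nat.descFactorial_self]

/-- the injective tuples with values in `Q` and image `F ⊆ Q`, `|F| = m`, are the injective tuples with values in `F`.
[cite: BalabanImbrieJaffe1988, p.310 (Sect. 5.14)] -/
theorem filter_image_eq {m : ℕ} {Q F : Finset α} (hFQ : F ⊆ Q) (hF : F.card = m) :
    ((Fintype.piFinset fun _ : Fin m => Q).filter fun Z => Function.Injective Z).filter (fun Z => univ.image Z = F) =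
      (Fintype.piFinset fun _ : Fin m => F).filter fun Z => Function.Injective Z := by
  ext Z
  simp only [mem_filter, Fintype.mem_piFinset]
  constructor
  · rintro ⟨⟨-, hinj⟩, himg⟩
    exact ⟨fun i => himg ▸ mem_image_of_mem Z (mem_univ i), hinj⟩
  · rintro ⟨hZF, hinj⟩
    have hsub : univ.image Z ⊆ F := image_subset_iff.2 fun i _ => hZF i
    have hcard : F.card ≤ (univ.image Z).card := by
      rw [card_image_of_injective _ hinj, card_univ, Fintype.card_fin, hF]
    exact ⟨⟨fun i => hFQ (hZF i), hinj⟩, eq_of_subset_of_card_le hsub hcard⟩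

/-- **READING (a) of `BIJ88ConnectedGraphResummation` as a theorem**: summing a function of the IMAGE over the injective `m`-tuples with values in
`Q` gives `m!` times the sum over the `m`-element sub-families of `Q`. [cite: BalabanImbrieJaffe1988, p.310 (Sect. 5.14)] -/
theorem sum_injective_piFinset_eq_smul {M : Type*} [AddCommMonoid M] {m : ℕ} (Q : Finset α) (G : Finset α → M) :
    ∑ Z ∈ (Fintype.piFinset fun _ : Fin m => Q).filter (fun Z => Function.Injective Z), G (univ.image Z) =
      m.factorial • ∑ F ∈ Q.powersetCard m, G F := by
  rw [smul_sum, ← sum_fiberwise_of_maps_to (s := (Fintype.piFinset fun _ : Fin m => Q).filter fun Z => Function.Injective Z)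
    (t := Q.powersetCard m) (g := fun Z => univ.image Z) fun Z hZ => ?_]
  · refine sum_congr rfl fun F hF => ?_
    obtain ⟨hFQ, hFm⟩ := mem_powersetCard.1 hF
    rw [sum_congr rfl fun Z hZ => by rw [(mem_filter.1 hZ).2], sum_const, filter_image_eq hFQ hFm,
      card_filter_injective_piFinset hFm]
  · obtain ⟨hZQ, hinj⟩ := mem_filter.1 hZ
    rw [Fintype.mem_piFinset] at hZQ
    exact mem_powersetCard.2 ⟨image_subset_iff.2 fun i _ => hZQ i, by rw [card_image_of_injective _ hinj, card_univ, Fintype.card_fin]⟩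

end Counting

/-! ## §2 The labels are forced: `N(K)` as a sum over cluster families -/

section Labels

variable {V : Type*} {S : Type*} [DecidableEq V] [DecidableEq S] (loc : S → V)

/-- **the labelled families over pairwise disjoint clusters are forced** (p. 309: *"H_β ⊂ H specifies which (d/dt)_{γ_j} have supports intersecting
X_β … the partition of H determined by the {X_β}"*; p. 310: *"the corresponding subsets of H remain the same – no duplication of
t-derivatives"*): `(H_i)` is an ordered weak partition of `K` covering through `loc` iff `H_i = slotsIn loc K Z_i` for all `i` and the `Z_i` cover
the slots. [cite: BalabanImbrieJaffe1988, p.309 (Sect. 5.14)] -/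
theorem owp_cov_iff {κ : Type*} [Fintype κ] {K : Finset S} {Z : κ → Finset V}
    (hZ : ∀ i j, i ≠ j → Disjoint (Z i) (Z j)) (Hs : κ → Finset S) :
    OWP K Hs ∧ Cov loc Hs Z ↔ (Hs = fun i => slotsIn loc K (Z i)) ∧ ∀ j ∈ K, ∃ i, loc j ∈ Z i := by
  constructor
  · rintro ⟨⟨hdisj, hU⟩, hcov⟩
    have hmemK : ∀ {i j}, j ∈ Hs i → j ∈ K := fun {i j} hj => hU ▸ mem_biUnion.2 ⟨i, mem_univ i, hj⟩
    refine ⟨funext fun i => ?_, fun j hj => ?_⟩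
    · ext j
      rw [mem_slotsIn]
      constructor
      · exact fun hj => ⟨hmemK hj, hcov i j hj⟩
      · rintro ⟨hjK, hjZ⟩
        rw [← hU] at hjK
        obtain ⟨i', -, hji'⟩ := mem_biUnion.1 hjK
        by_cases hii' : i' = i
        · exact hii' ▸ hji'
        · exact (disjoint_left.1 (hZ i' i hii') (hcov i' j hji') hjZ).elim
    · rw [← hU] at hj
      obtain ⟨i, -, hji⟩ := mem_biUnion.1 hj
      exact ⟨i, hcov i j hji⟩
  · rintro ⟨rfl, hcov⟩
    refine ⟨⟨fun i i' hii' => disjoint_slotsIn (hZ i i' hii'), ?_⟩, fun i j hj => (mem_slotsIn.1 hj).2⟩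
    ext j
    simp only [mem_biUnion, mem_univ, true_and, mem_slotsIn]
    exact ⟨fun ⟨_, hjK, _⟩ => hjK, fun hjK => (hcov j hjK).imp fun i hi => ⟨hjK, hi⟩⟩

omit [DecidableEq V] [DecidableEq S] in
/-- polymers are nonempty: a pairwise disjoint tuple of polymers is injective. [cite: BalabanImbrieJaffe1988, p.310 (Sect. 5.14)] -/
theorem injective_of_disjoint {Q : Finset (Finset V)} (hQ : ∅ ∉ Q) {κ : Type*} {Z : κ → Finset V} (hZQ : ∀ i, Z i ∈ Q)
    (hZ : ∀ i j, i ≠ j → Disjoint (Z i) (Z j)) : Function.Injective Z := by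
  intro i j hij
  by_contra hne
  have hd := hZ i j hne
  rw [hij, disjoint_self, bot_eq_empty] at hd
  exact hQ (hd ▸ hZQ j)

/-- the constraint on families: pairwise disjoint (*"nonoverlapping"*) and covering the slots (*"must cover all cubes connected with the
(d/dt)_{γ_j}"*). [cite: BalabanImbrieJaffe1988, p.309 (Sect. 5.14)] -/
def FamOK (K : Finset S) (F : Finset (Finset V)) : Prop :=
  (∀ X ∈ F, ∀ Y ∈ F, X ≠ Y → Disjoint X Y) ∧ Covers loc K F

/-- decidability of the family constraint. [cite: BalabanImbrieJaffe1988, p.309 (Sect. 5.14)] -/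
instance instDecidableFamOK (K : Finset S) (F : Finset (Finset V)) : Decidable (FamOK loc K F) := by
  unfold FamOK; infer_instance

end Labels

section Families

variable {V : Type*} {S : Type*} [DecidableEq V] [Fintype V] [DecidableEq S] [Fintype S]
  (Q : Finset (Finset V)) (loc : S → V) (w : Finset S → Finset V → ℝ)

omit [Fintype V] [DecidableEq S] [Fintype S] in
/-- pairwise disjointness of a cluster tuple, as gen 6's hard core reads it. [cite: BalabanImbrieJaffe1988, p.310 (Sect. 5.14)] -/
theorem hardCore_univ_eq {κ : Type*} [Fintype κ] [DecidableEq κ] (Z : κ → Finset V) :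
    hardCore Z univ = if ∀ i j, i ≠ j → Disjoint (Z i) (Z j) then 1 else 0 := by
  by_cases h : ∀ i j, i ≠ j → Disjoint (Z i) (Z j)
  · rw [if_pos h]
    unfold hardCore
    exact if_pos fun i _ j _ hij => h i j hij
  · rw [if_neg h]
    unfold hardCore
    exact if_neg fun h' => h fun i j hij => h' i (mem_univ i) j (mem_univ j) hij

/-- **gen 6's raw sum over labelled families is a sum over cluster tuples alone**, the labels being forced:
`Nraw Q loc w κ K = Σ_{Z : κ → Q} 𝟙[Z covers the slots] · hardCore(Z) · Π_i w(slotsIn loc K Z_i, Z_i)`. [cite: BalabanImbrieJaffe1988, p.309 (Sect. 5.14)] -/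
theorem Nraw_eq_sum_tuples {κ : Type*} [Fintype κ] [DecidableEq κ] (K : Finset S) :
    Nraw Q loc w κ K = ∑ Z : κ → Finset V,
      if InQ Q Z ∧ ∀ j ∈ K, ∃ i, loc j ∈ Z i then (hardCore Z univ : ℝ) * ∏ i, w (slotsIn loc K (Z i)) (Z i) else 0 := by
  rw [Nraw, sum_comm]
  refine sum_congr rfl fun Z _ => ?_
  by_cases hZ : ∀ i j, i ≠ j → Disjoint (Z i) (Z j)
  · by_cases hQZ : InQ Q Z
    · rw [sum_eq_single (fun i => slotsIn loc K (Z i))]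
      · by_cases hcov : ∀ j ∈ K, ∃ i, loc j ∈ Z i
        · have h := (owp_cov_iff loc hZ (fun i => slotsIn loc K (Z i))).2 ⟨rfl, hcov⟩
          rw [if_pos ⟨h.1, hQZ, h.2⟩, if_pos ⟨hQZ, hcov⟩]
          rfl
        · rw [if_neg fun h => hcov ((owp_cov_iff loc hZ _).1 ⟨h.1, h.2.2⟩).2, if_neg fun h => hcov h.2]
      · intro Hs _ hne
        rw [if_neg fun h => hne ((owp_cov_iff loc hZ Hs).1 ⟨h.1, h.2.2⟩).1]
      · exact fun h => (h (mem_univ _)).elim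
    · rw [if_neg fun h => hQZ h.1]
      exact sum_eq_zero fun Hs _ => if_neg fun h => hQZ h.2.1
  · have h0 : (hardCore Z univ : ℝ) = 0 := by rw [hardCore_univ_eq, if_neg hZ]; simp
    rw [h0]
    simp only [zero_mul, ite_self, sum_const_zero]

variable {Q loc w}

/-- **`Nraw (Fin m) = m! ×` the sum over the `m`-cluster nonoverlapping covering families** (READING (a) of gen 6 for `N`: *"an unordered
nonoverlapping family {X_γ} ∪ {Y_δ} of m clusters is counted m! times"*). [cite: BalabanImbrieJaffe1988, p.309 (Sect. 5.14)] -/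
theorem Nraw_fin_eq (hQ : ∅ ∉ Q) (m : ℕ) (K : Finset S) :
    Nraw Q loc w (Fin m) K = (m.factorial : ℝ) * ∑ F ∈ (Q.powersetCard m).filter (FamOK loc K), ∏ X ∈ F, w (slotsIn loc K X) X := by
  -- the term of a tuple, as a function of its image on injective tuples
  let G : Finset (Finset V) → ℝ := fun F => if FamOK loc K F then ∏ X ∈ F, w (slotsIn loc K X) X else 0
  let filt : Finset (Fin m → Finset V) := (Fintype.piFinset fun _ : Fin m => Q).filter fun Z => Function.Injective Z
  have hfilt : (univ.filter fun Z : Fin m → Finset V => Z ∈ filt) = filt := by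
    ext Z
    simp only [mem_filter, mem_univ, true_and]
  rw [Nraw_eq_sum_tuples]
  trans ∑ Z : Fin m → Finset V, (if Z ∈ filt then G (univ.image Z) else 0)
  · refine sum_congr rfl fun Z _ => ?_
    by_cases hQZ : InQ Q Z
    · by_cases hinj : Function.Injective Z
      · have hmem : Z ∈ filt := mem_filter.2 ⟨Fintype.mem_piFinset.2 hQZ, hinj⟩
        rw [if_pos hmem]
        by_cases hZ : ∀ i j, i ≠ j → Disjoint (Z i) (Z j)
        · have hpd : ∀ X ∈ univ.image Z, ∀ Y ∈ univ.image Z, X ≠ Y → Disjoint X Y := by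
            intro X hX Y hY hne
            obtain ⟨i, -, rfl⟩ := mem_image.1 hX
            obtain ⟨j, -, rfl⟩ := mem_image.1 hY
            exact hZ i j fun h => hne (h ▸ rfl)
          have hcov : (∀ j ∈ K, ∃ i, loc j ∈ Z i) ↔ Covers loc K (univ.image Z) :=
            ⟨fun h j hj => (h j hj).elim fun i hi => ⟨Z i, mem_image_of_mem Z (mem_univ i), hi⟩,
              fun h j hj => by
                obtain ⟨X, hX, hjX⟩ := h j hj
                obtain ⟨i, -, rfl⟩ := mem_image.1 hX
                exact ⟨i, hjX⟩⟩
          have h1 : (hardCore Z univ : ℝ) = 1 := by rw [hardCore_univ_eq, if_pos hZ]; simp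
          rw [h1, one_mul]
          by_cases hc : ∀ j ∈ K, ∃ i, loc j ∈ Z i
          · have hG : G (univ.image Z) = ∏ X ∈ univ.image Z, w (slotsIn loc K X) X := if_pos ⟨hpd, hcov.1 hc⟩
            rw [if_pos ⟨hQZ, hc⟩, hG, prod_image fun i _ j _ h => hinj h]
          · have hG : G (univ.image Z) = 0 := if_neg fun h => hc (hcov.2 h.2)
            rw [if_neg fun h => hc h.2, hG]
        · have h0 : (hardCore Z univ : ℝ) = 0 := by rw [hardCore_univ_eq, if_neg hZ]; simp
          have hG : G (univ.image Z) = 0 := by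
            refine if_neg fun h => hZ fun i j hij => h.1 _ (mem_image_of_mem Z (mem_univ i)) _ (mem_image_of_mem Z (mem_univ j)) ?_
            exact fun h' => hij (hinj h')
          rw [h0, hG]
          simp only [zero_mul, ite_self]
      · have hZ : ¬ ∀ i j, i ≠ j → Disjoint (Z i) (Z j) := fun h => hinj (injective_of_disjoint hQ hQZ h)
        have h0 : (hardCore Z univ : ℝ) = 0 := by rw [hardCore_univ_eq, if_neg hZ]; simp
        rw [h0, if_neg fun h => hinj (mem_filter.1 h).2]
        simp only [zero_mul, ite_self]
    · rw [if_neg fun h => hQZ h.1, if_neg fun h => hQZ (Fintype.mem_piFinset.1 (mem_filter.1 h).1)]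
  · rw [← sum_filter, hfilt, sum_injective_piFinset_eq_smul Q G, nsmul_eq_mul, sum_filter]

/-- **`Nord m K` = the sum over the `m`-cluster nonoverlapping covering families** (no factorial left). [cite: BalabanImbrieJaffe1988, p.309 (Sect. 5.14)] -/
theorem Nord_eq (hQ : ∅ ∉ Q) (m : ℕ) (K : Finset S) :
    Nord Q loc w m K = ∑ F ∈ (Q.powersetCard m).filter (FamOK loc K), ∏ X ∈ F, w (slotsIn loc K X) X := by
  have hm : (m.factorial : ℝ) ≠ 0 := by positivity
  rw [Nord, Nraw_fin_eq hQ, mul_div_cancel_left₀ _ hm]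

/-- no term with more clusters than polymers. [cite: BalabanImbrieJaffe1988, p.309 (Sect. 5.14)] -/
theorem Nord_eq_zero_of_lt (hQ : ∅ ∉ Q) {m : ℕ} (hm : Q.card < m) (K : Finset S) : Nord Q loc w m K = 0 := by
  rw [Nord_eq hQ, powersetCard_eq_empty.2 hm, filter_empty, sum_empty]

/-- **`N(K)` = THE SUM OVER THE NONOVERLAPPING COVERING FAMILIES** (the last display of p. 309, unordered as printed: *"Σ_{{H_γ}∈𝒫(H)}
Σ_{{X_γ},{Y_δ} nonoverlapping} Π_γ g₃(H_γ,X_γ) Π_δ g₃(∅,Y_δ)"* with `H_γ = slotsIn loc K X_γ` forced): `Nsum Q loc w K = Σ_{F ⊆ Q nonoverlapping,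
covering} Π_{X∈F} w(H(X), X)`. [cite: BalabanImbrieJaffe1988, p.309 (Sect. 5.14)] -/
theorem Nsum_eq_sum_families (hQ : ∅ ∉ Q) (K : Finset S) :
    Nsum Q loc w K = ∑ F ∈ Q.powerset.filter (FamOK loc K), ∏ X ∈ F, w (slotsIn loc K X) X := by
  rw [Nsum, tsum_eq_sum (s := range (Q.card + 1)) fun m hm => ?_]
  · rw [sum_filter, powerset_card_disjiUnion, sum_disjiUnion]
    refine sum_congr rfl fun m _ => ?_
    rw [Nord_eq hQ, sum_filter]
  · rw [mem_range, not_lt] at hm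
    exact Nord_eq_zero_of_lt hQ (Nat.lt_of_succ_le hm) K

end Families

/-! ## §3 The link, overlap hard core: `N(K)` with the prime-dropped activity is the all-fillings expansion -/

section LinkAll

variable {ι : Type*} {S : Type*}

/-- the polymer family of the overlap-only gas: the nonempty sets of cubes of `W` (*"X's are arbitrary connected unions of r(e_k)-cubes"*; no
connectedness is imposed here — a disconnected `X` carries activity `0` in the applications, `BIJ88PolymerRep5134.g1_of_two_le`).
[cite: BalabanImbrieJaffe1988, p.309 (Sect. 5.14)] -/
def polysOf (W : Finset ι) : Finset (Finset ι) := W.powerset.filter fun X => X.Nonempty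

/-- `∅` is not a polymer. [cite: BalabanImbrieJaffe1988, p.309 (Sect. 5.14)] -/
theorem empty_notMem_polysOf (W : Finset ι) : (∅ : Finset ι) ∉ polysOf W := fun h => not_nonempty_empty (mem_filter.1 h).2

variable [DecidableEq ι] (loc : S → ι)

/-- the nonoverlapping covering families of `BIJ88Expansion5143` are the `FamOK` sub-families of `polysOf W`.
[cite: BalabanImbrieJaffe1988, p.309 (Sect. 5.14)] -/
theorem filter_nonoverlapping_eq (W : Finset ι) (K : Finset S) :
    (nonoverlapping W).filter (Covers loc K) = (polysOf W).powerset.filter (FamOK loc K) := by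
  ext F
  simp only [nonoverlapping, polysOf, FamOK, mem_filter, mem_powerset, and_assoc]

variable [Fintype ι] [DecidableEq S] [Fintype S]

/-- **THE LINK (overlap hard core).** For every activity `g(H, X)`, gen 6's `N(K)` built on the nonempty sets of cubes of `W` with the PRIME-DROPPED
activity `prime g` equals the sum over ALL fillings of `W` of `Π_{X∈P} g(H(X), X)`: READING (b) of `BIJ88ConnectedGraphResummation` (*"N(K) is
DEFINED as that expansion of the un-normalized expectation"*) meets the derived expansion. [cite: BalabanImbrieJaffe1988, p.309 (Sect. 5.14)] -/
theorem Nsum_eq_sum_setPartitions {W : Finset ι} (g : Finset S → Finset ι → ℝ) {K : Finset S} (hK : ∀ j ∈ K, loc j ∈ W) :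
    Nsum (polysOf W) loc (prime g) K = ∑ P ∈ setPartitions W, ∏ X ∈ P, g (slotsIn loc K X) X := by
  rw [Nsum_eq_sum_families (empty_notMem_polysOf W), dropPrime_all loc K g hK, filter_nonoverlapping_eq]

end LinkAll

/-! ## §4 The link for the cluster configurations of (5.13.4)/(5.14.3): admissibility as an overlap hard core of virtual supports -/

section CInc

variable {ι : Type*} [DecidableEq ι] (adj : ι → ι → Prop) [DecidableRel adj]

/-- **the incompatibility of the cluster-configuration gas**: equal, or overlapping, or both of at least two cubes and abutting (the complement of
*"nonoverlapping"* + `IsAdmissible`). [cite: BalabanImbrieJaffe1988, (5.14.3) p.309] -/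
def cinc (X Y : Finset ι) : Prop := X = Y ∨ ¬ Disjoint X Y ∨ (2 ≤ X.card ∧ 2 ≤ Y.card ∧ ∃ a ∈ X, ∃ b ∈ Y, adj a b ∨ adj b a)

/-- decidability of `cinc`. [cite: BalabanImbrieJaffe1988, (5.14.3) p.309] -/
instance instDecidableRelCinc : DecidableRel (cinc adj) := fun X Y => by
  unfold cinc; infer_instance

variable {adj}

omit [DecidableEq ι] [DecidableRel adj] in
/-- `cinc` is reflexive. [cite: BalabanImbrieJaffe1988, (5.14.3) p.309] -/
theorem cinc_refl (X : Finset ι) : cinc adj X X := Or.inl rfl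

omit [DecidableEq ι] [DecidableRel adj] in
/-- `cinc` is symmetric. [cite: BalabanImbrieJaffe1988, (5.14.3) p.309] -/
theorem cinc_symm {X Y : Finset ι} (h : cinc adj X Y) : cinc adj Y X := by
  rcases h with rfl | h | ⟨hX, hY, a, ha, b, hb, hab⟩
  · exact Or.inl rfl
  · exact Or.inr (Or.inl fun hd => h hd.symm)
  · exact Or.inr (Or.inr ⟨hY, hX, b, hb, a, ha, hab.symm⟩)

omit [DecidableEq ι] [DecidableRel adj] in
/-- overlapping polymers are incompatible. [cite: BalabanImbrieJaffe1988, (5.14.3) p.309] -/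
theorem cinc_of_not_disjoint (X Y : Finset ι) (h : ¬ Disjoint (id X) (id Y)) : cinc adj X Y := Or.inr (Or.inl h)

omit [DecidableEq ι] [DecidableRel adj] in
/-- **pairwise `cinc`-compatibility = nonoverlapping and admissible.** [cite: BalabanImbrieJaffe1988, (5.14.3) p.309] -/
theorem pairwise_not_cinc_iff (F : Finset (Finset ι)) :
    (∀ X ∈ F, ∀ Y ∈ F, X ≠ Y → ¬ cinc adj X Y) ↔ (∀ X ∈ F, ∀ Y ∈ F, X ≠ Y → Disjoint X Y) ∧ IsAdmissible adj F := by
  constructor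
  · intro h
    refine ⟨fun X hX Y hY hne => ?_, fun X hX Y hY hne h2 h2' a ha b hb hab => ?_⟩
    · by_contra hd
      exact h X hX Y hY hne (Or.inr (Or.inl hd))
    · exact h X hX Y hY hne (Or.inr (Or.inr ⟨h2, h2', a, ha, b, hb, Or.inl hab⟩))
  · rintro ⟨hd, hadm⟩ X hX Y hY hne (h | h | ⟨h2, h2', a, ha, b, hb, hab⟩)
    · exact hne h
    · exact h (hd X hX Y hY hne)
    · rcases hab with hab | hab
      · exact hadm X hX Y hY hne h2 h2' a ha b hb hab
      · exact hadm Y hY X hX (Ne.symm hne) h2' h2 b hb a ha hab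

variable (adj) (W : Finset ι)

/-- the virtual support of a cube polymer of `W` (this seat's gen-9 `BIJ88VirtualSupports310.vsupp` for the incompatibility `cinc` on the
polymers of `W`): its cubes and the incompatible pairs through it. [cite: BalabanImbrieJaffe1988, p.310 (Sect. 5.14)] -/
abbrev cvsupp : Finset ι → Finset (ι ⊕ (Finset ι × Finset ι)) := vsupp (cinc adj) id (polysOf W)

variable {S : Type*} (loc : S → ι)

/-- the slot locations among the virtual cubes. [cite: BalabanImbrieJaffe1988, p.310 (Sect. 5.14)] -/
def locv : S → ι ⊕ (Finset ι × Finset ι) := fun j => Sum.inl (loc j)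

variable {adj W loc}

/-- the slots located in a virtual support are the slots located in the polymer. [cite: BalabanImbrieJaffe1988, p.310 (Sect. 5.14)] -/
theorem slotsIn_vsupp (K : Finset S) (X : Finset ι) : slotsIn (locv loc) K (cvsupp adj W X) = slotsIn loc K X := by
  ext j
  simp only [mem_slotsIn, locv]
  exact and_congr_right fun _ => inl_mem_vsupp_iff

/-- a family of virtual supports covers the slots iff the family of polymers does (*"The {X_β} must cover all cubes connected with the
(d/dt)_{γ_j}"* is unchanged). [cite: BalabanImbrieJaffe1988, p.309 (Sect. 5.14)] -/
theorem covers_image_vsupp_iff (K : Finset S) (F : Finset (Finset ι)) :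
    Covers (locv loc) K (F.image (cvsupp adj W)) ↔ Covers loc K F := by
  constructor
  · intro h j hj
    obtain ⟨Zv, hZv, hj'⟩ := h j hj
    obtain ⟨X, hX, rfl⟩ := mem_image.1 hZv
    exact ⟨X, hX, inl_mem_vsupp_iff.1 hj'⟩
  · intro h j hj
    obtain ⟨X, hX, hjX⟩ := h j hj
    exact ⟨cvsupp adj W X, mem_image_of_mem _ hX, inl_mem_vsupp_iff.2 hjX⟩

/-- two virtual supports of polymers of `W` are disjoint iff the polymers are `cinc`-compatible. [cite: BalabanImbrieJaffe1988, p.310 (Sect. 5.14)] -/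
theorem disjoint_vsupp_iff {X Y : Finset ι} (hX : X ∈ polysOf W) (hY : Y ∈ polysOf W) :
    Disjoint (cvsupp adj W X) (cvsupp adj W Y) ↔ ¬ cinc adj X Y := by
  rw [← not_disjoint_vsupp_iff cinc_refl (fun _ _ => cinc_symm) cinc_of_not_disjoint hX hY, not_not]

/-- **the `FamOK` families of virtual supports are the images of the nonoverlapping admissible covering families.**
[cite: BalabanImbrieJaffe1988, p.310 (Sect. 5.14)] -/
theorem famOK_image_iff {K : Finset S} {F : Finset (Finset ι)} (hF : F ⊆ polysOf W) :
    FamOK (locv loc) K (F.image (cvsupp adj W)) ↔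
      ((∀ X ∈ F, ∀ Y ∈ F, X ≠ Y → Disjoint X Y) ∧ IsAdmissible adj F) ∧ Covers loc K F := by
  rw [FamOK, covers_image_vsupp_iff, ← pairwise_not_cinc_iff]
  refine and_congr_left fun _ => ⟨fun h X hX Y hY hne => ?_, fun h Zv hZv Zw hZw hne => ?_⟩
  · exact (disjoint_vsupp_iff (hF hX) (hF hY)).1 (h _ (mem_image_of_mem _ hX) _ (mem_image_of_mem _ hY) fun he => hne (vsupp_injective he))
  · obtain ⟨X, hX, rfl⟩ := mem_image.1 hZv
    obtain ⟨Y, hY, rfl⟩ := mem_image.1 hZw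
    exact (disjoint_vsupp_iff (hF hX) (hF hY)).2 (h X hX Y hY fun he => hne (he ▸ rfl))

/-- `∅` is not a virtual support of a polymer. [cite: BalabanImbrieJaffe1988, p.310 (Sect. 5.14)] -/
theorem empty_notMem_image_vsupp : (∅ : Finset (ι ⊕ (Finset ι × Finset ι))) ∉ (polysOf W).image (cvsupp adj W) := by
  intro h
  obtain ⟨X, hX, hXe⟩ := mem_image.1 h
  obtain ⟨c, hc⟩ := (mem_filter.1 hX).2
  have hc' : (Sum.inl c : ι ⊕ (Finset ι × Finset ι)) ∈ cvsupp adj W X := inl_mem_vsupp_iff.2 hc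
  rw [hXe] at hc'
  exact notMem_empty _ hc'

variable [Fintype ι]

/-- the cube content of a set of virtual cubes. [cite: BalabanImbrieJaffe1988, p.310 (Sect. 5.14)] -/
def cubesOf (Zv : Finset (ι ⊕ (Finset ι × Finset ι))) : Finset ι := univ.filter fun c => (Sum.inl c : ι ⊕ (Finset ι × Finset ι)) ∈ Zv

/-- the pulled-back activity on virtual supports: the activity of the cube content. [cite: BalabanImbrieJaffe1988, p.310 (Sect. 5.14)] -/
def wv (w : Finset S → Finset ι → ℝ) (H : Finset S) (Zv : Finset (ι ⊕ (Finset ι × Finset ι))) : ℝ := w H (cubesOf Zv)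

/-- the cube content of a virtual support is the polymer. [cite: BalabanImbrieJaffe1988, p.310 (Sect. 5.14)] -/
theorem cubesOf_vsupp (X : Finset ι) : cubesOf (cvsupp adj W X) = X := by
  ext c
  simp only [cubesOf, mem_filter, mem_univ, true_and]
  exact inl_mem_vsupp_iff

/-- the pulled-back activity of a virtual support is the activity of the polymer. [cite: BalabanImbrieJaffe1988, p.310 (Sect. 5.14)] -/
theorem wv_vsupp (w : Finset S → Finset ι → ℝ) (H : Finset S) (X : Finset ι) : wv w H (cvsupp adj W X) = w H X := by
  rw [wv, cubesOf_vsupp]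

/-- **gen 6's family sum over the virtual supports is the sum over the nonoverlapping ADMISSIBLE covering families of polymers.**
[cite: BalabanImbrieJaffe1988, p.310 (Sect. 5.14)] -/
theorem sum_famOK_vsupp_eq (w : Finset S → Finset ι → ℝ) (K : Finset S) :
    ∑ Fv ∈ ((polysOf W).image (cvsupp adj W)).powerset.filter (FamOK (locv loc) K), ∏ Zv ∈ Fv, wv w (slotsIn (locv loc) K Zv) Zv =
      ∑ F ∈ (nonoverlapping W).filter (fun F => IsAdmissible adj F ∧ Covers loc K F), ∏ X ∈ F, w (slotsIn loc K X) X := by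
  symm
  refine sum_nbij' (fun F => F.image (cvsupp adj W)) (fun Fv => (polysOf W).filter fun X => cvsupp adj W X ∈ Fv) ?_ ?_ ?_ ?_ ?_
  · intro F hF
    obtain ⟨hF, hadm, hcov⟩ := mem_filter.1 hF
    obtain ⟨hFW, hd⟩ := mem_nonoverlapping.1 hF
    have hFp : F ⊆ polysOf W := fun X hX => mem_filter.2 ⟨mem_powerset.2 (hFW X hX).1, (hFW X hX).2⟩
    exact mem_filter.2 ⟨mem_powerset.2 (image_subset_image hFp), (famOK_image_iff hFp).2 ⟨⟨hd, hadm⟩, hcov⟩⟩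
  · intro Fv hFv
    obtain ⟨hFv, hok⟩ := mem_filter.1 hFv
    have hsub : (polysOf W).filter (fun X => cvsupp adj W X ∈ Fv) ⊆ polysOf W := filter_subset _ _
    have himg : ((polysOf W).filter fun X => cvsupp adj W X ∈ Fv).image (cvsupp adj W) = Fv := by
      ext Zv
      simp only [mem_image, mem_filter]
      constructor
      · rintro ⟨X, ⟨-, hX⟩, rfl⟩
        exact hX
      · intro hZv
        obtain ⟨X, hX, rfl⟩ := mem_image.1 (mem_powerset.1 hFv hZv)
        exact ⟨X, ⟨hX, hZv⟩, rfl⟩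
    rw [← himg, famOK_image_iff hsub] at hok
    obtain ⟨⟨hd, hadm⟩, hcov⟩ := hok
    refine mem_filter.2 ⟨mem_nonoverlapping.2 ⟨fun X hX => ?_, hd⟩, hadm, hcov⟩
    have hXp := (mem_filter.1 hX).1
    exact ⟨mem_powerset.1 (mem_filter.1 hXp).1, (mem_filter.1 hXp).2⟩
  · intro F hF
    obtain ⟨hF, -, -⟩ := mem_filter.1 hF
    obtain ⟨hFW, -⟩ := mem_nonoverlapping.1 hF
    ext X
    simp only [mem_filter, mem_image]
    constructor
    · rintro ⟨-, Y, hY, hYX⟩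
      exact vsupp_injective hYX ▸ hY
    · intro hX
      exact ⟨mem_filter.2 ⟨mem_powerset.2 (hFW X hX).1, (hFW X hX).2⟩, X, hX, rfl⟩
  · intro Fv hFv
    obtain ⟨hFv, -⟩ := mem_filter.1 hFv
    ext Zv
    simp only [mem_image, mem_filter]
    constructor
    · rintro ⟨X, ⟨-, hX⟩, rfl⟩
      exact hX
    · intro hZv
      obtain ⟨X, hX, rfl⟩ := mem_image.1 (mem_powerset.1 hFv hZv)
      exact ⟨X, ⟨hX, hZv⟩, rfl⟩
  · intro F hF
    rw [prod_image fun X _ Y _ h => vsupp_injective h]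
    exact prod_congr rfl fun X _ => by rw [slotsIn_vsupp, wv_vsupp]

variable [DecidableEq S] [Fintype S]

/-- **THE LINK (cluster configurations).** For every activity `g(H, X)`, gen 6's `N(K)` over the VIRTUAL SUPPORTS of the polymers of `W` (overlap
hard core = `cinc`-incompatibility = overlap or two abutting multi-cube polymers), with the pulled-back prime-dropped activity, equals the sum
over the ADMISSIBLE fillings of `W` (the cluster configurations of (5.13.4)/(5.14.3)) of `Π_{X∈P} g(H(X), X)`. [cite: BalabanImbrieJaffe1988, p.309 (Sect. 5.14)] -/
theorem Nsum_vsupp_eq_expansion {W : Finset ι} (g : Finset S → Finset ι → ℝ) {K : Finset S} (hK : ∀ j ∈ K, loc j ∈ W) :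
    Nsum ((polysOf W).image (cvsupp adj W)) (locv loc) (wv (prime g)) K =
      ∑ P ∈ (setPartitions W).filter (IsAdmissible adj), ∏ X ∈ P, g (slotsIn loc K X) X := by
  rw [Nsum_eq_sum_families empty_notMem_image_vsupp, sum_famOK_vsupp_eq, dropPrime_admissible loc K adj g hK]

/-- **`N(K)` IS THE UN-NORMALIZED EXPECTATION** (READING (b) of `BIJ88ConnectedGraphResummation` made a theorem): for slot-local corner expectations
`z` with `z K` cluster-factorizing (`BIJ88Expansion5143.expansion5143`), the expectation `z K W W = ⟨Π_{j∈K}(d/dt)_{γ_j} Π_{i∈W} f(□_i)⟩_1` equals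
gen 6's `Nsum` over the virtual supports of the polymers of `W` with the prime-dropped activity `wv (prime (g3 adj z))` — the object from which
displays 1–3 of p. 310 were derived (`Nsum_eq_mul_Dsum`, `Dsum_eq_sum_setPartitions`, `display3`). [cite: BalabanImbrieJaffe1988, (5.14.3) p.309] -/
theorem Nsum_vsupp_eq_corner {W : Finset ι} {z : Finset S → Finset ι → Finset ι → ℝ} {K : Finset S}
    (hz : IsClusterFactorizing adj (z K)) (hloc : IsSlotLocal loc z) (hK : ∀ j ∈ K, loc j ∈ W) :
    Nsum ((polysOf W).image (cvsupp adj W)) (locv loc) (wv (prime (g3 adj z))) K = z K W W := by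
  rw [Nsum_vsupp_eq_expansion (g3 adj z) hK, expansion5143 hz hloc W]

end CInc

end Literature.MathematicalPhysics.QuantumFieldTheory.BalabanImbrieJaffe1984to88.BIJ88Expansion5143Ordered
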